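import Summits.HodgeConjecture.HodgeConjecture.Theses.NikulinTwinTransport
import Summits.HodgeConjecture.HodgeConjecture.Theorems.NikulinTwinTransportTwinSimilitudeReduction
import Literature.AlgebraicGeometry.HodgeTheory.GysinBaseChange
import Literature.AlgebraicGeometry.HodgeTheory.AlgebraicClassesCup

/-!
# Route NikulinTwinTransport · item `TwinAnchorGlue` (stmt-HodgeConjecture-14394) — the glue to the
# target, reduced to the multiplicativity `N² ∪ N² ⊆ N⁴` on triple products of surfaces

The support item `TwinAnchorGlue : HodgeIsometryAlgebraic → TwinTwistorTransport →
TwinSimilitudeAlgebraic` (Varesco, Math. Z. 305 (2023), §2, "similarity = algebraic similarity ∘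
isometry", with the twin in place of the Nikulin quotient): given a rational, type-preserving
`2`-similitude `ψ : H²(S′(ℂ); ℂ) → H²(S(ℂ); ℂ)` between projective K3 surfaces, the algebraic anchor
`Ψ : H²(S″) ≃ H²(S)` of `S` (crux `TwinTwistorTransport`) makes `φ := Ψ⁻¹ ∘ ψ` a rational Hodge
ISOMETRY `H²(S′) → H²(S″)`, algebraic by `HodgeIsometryAlgebraic` (Buskin) for the pair `(S″, S′)`,
and `ψ = Ψ ∘ φ` is algebraic by COMPOSITION OF ALGEBRAIC CORRESPONDENCES. In the tree the first two
steps are `Summit.HodgeConjecture.HodgeConjecture.Theorems.twinSimilitudeAlgebraic_of_anchor`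
(hypotheses (B) = `HodgeIsometryAlgebraic`, (A) = `TwinTwistorTransport` verbatim, and (C) =
composition of algebraic degree-`2` correspondences between smooth projective surfaces acting on
`H²`), and (C) is `Literature.AlgebraicGeometry.HodgeTheory.corrComp_surfaces_of_cup'` (Buskin
Lemma 6.3 / Fulton Prop. 16.1.1: `γ₂ = c • p₁₃_*(p₁₂^* γ ∪ p₂₃^* γ₁)`; the Künneth spanning property
and Gysin base change for product squares are THEOREMS of the tree, `kunnethSpan_complexBetti`,
`gysin_baseChange`), granted ONLY the multiplicativity `N² H⁴ ∪ N² H⁴ ⊆ N⁴ H⁸` of algebraically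
supported classes on the triple products `A ⊗ (B ⊗ C)` of smooth projective surfaces (Voisin II
Prop. 9.20; on the tree's coniveau carrier this is Chow's moving lemma + purity + a constructed
cycle class, deliberately not a named fact — module docstring of
`Literature/AlgebraicGeometry/HodgeTheory/AlgebraicClassesCup`, "What is NOT here").

This file records exactly what the item hinges on:

* `twinAnchorGlue_of_cup` — `TwinAnchorGlue` from that multiplicativity `hCUP` (the hypothesis of
  `corrComp_surfaces_of_cup'`, verbatim);
* `twinAnchorGlue_of_moving` — `TwinAnchorGlue` from the MOVING hypothesis of the tree's reduction
  theorem `cupProduct_mem_algebraicClasses_of_moving` on the `ℂ`-schemes `A ⊗ (B ⊗ C)` in degrees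
  `l = k = 2` (classes of `H⁴` killed off a closed `Z` of codimension `≥ 2` lie in the span of
  classes killed off closed `T` meeting a given closed `W` of codimension `≥ 2` in codimension
  `≥ 4`) — the printed content of Chow's moving lemma for `2`-cycles on a smooth projective
  sixfold, the one input the tree does not yet construct;
* `twinAnchorGlue_of_corrComp` — `TwinAnchorGlue` from hypothesis (C) itself (composition of
  algebraic correspondences between surfaces), for consumers that obtain (C) otherwise.

Conditional results (the item's own signature is `TwinAnchorGlue` with no hypothesis; it closes the
day `hCUP` — equivalently the moving input — is constructed for triple products of surfaces).

## References

* [Varesco2023] M. Varesco, Hodge similarities, algebraic classes, and Kuga–Satake varieties,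
  Math. Z. 305 (2023), §2 (arXiv:2304.02519).
* [Buskin2019] N. Buskin, Every rational Hodge isometry between two K3 surfaces is algebraic,
  J. reine angew. Math. 755 (2019), Thm. 1.1, §6.2 Lemma 6.3.
* [Fulton1998] W. Fulton, Intersection Theory, 2nd ed., Springer 1998, §16.1 Prop. 16.1.1, §11.4.
* [VoisinHodgeII2003] C. Voisin, Hodge Theory and Complex Algebraic Geometry II, CUP 2003, §9.2.4
  Prop. 9.20, Lemma 9.22.
-/

noncomputable section

namespace Summit.HodgeConjecture.HodgeConjecture.Theorems

open CategoryTheory MonoidalCategory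
open Literature.AlgebraicGeometry.HodgeTheory Literature.AlgebraicGeometry.Motives
open Literature.AlgebraicTopology.SingularHomology
open Summit.HodgeConjecture.HodgeConjecture.Theses.NikulinTwinTransport

/-- **`TwinAnchorGlue` from the composition of algebraic correspondences between surfaces**
(hypothesis (C) of `twinSimilitudeAlgebraic_of_anchor`: for smooth projective surfaces `A, B, C`
and algebraic `γ ∈ N²H⁴((A ⊗ B)(ℂ))`, `γ₁ ∈ N²H⁴((B ⊗ C)(ℂ))` there is an algebraic
`γ₂ ∈ N²H⁴((A ⊗ C)(ℂ))` with `[γ₂]_* = [γ]_* ∘ [γ₁]_*` on `H²(C(ℂ); ℂ)` — Buskin Lemma 6.3 /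
Fulton Prop. 16.1.1): then `HodgeIsometryAlgebraic → TwinTwistorTransport → TwinSimilitudeAlgebraic`,
the crux `TwinTwistorTransport` being verbatim the anchor hypothesis (A) of that glue (Varesco 2023
§2: `Ψ⁻¹ ∘ ψ` is a rational Hodge isometry, Buskin, compose with the anchor `Ψ = [γ]_*`).
[cite: Varesco2023, §2] [cite: Buskin2019, Lemma 6.3] -/
theorem twinAnchorGlue_of_corrComp
    (hC : ∀ (μ : OrientationFamily), μ.HasPoincareDuality →
      ∀ (A B C : SchemeOver ℂ) (hA : IsSmoothProjective 2 A) (hB : IsSmoothProjective 2 B)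
        (hC : IsSmoothProjective 2 C),
        ∀ γ ∈ algebraicClasses (MonoidalCategoryStruct.tensorObj A B) 2,
          ∀ γ₁ ∈ algebraicClasses (MonoidalCategoryStruct.tensorObj B C) 2,
            ∃ γ₂ ∈ algebraicClasses (MonoidalCategoryStruct.tensorObj A C) 2,
              ∀ x : complexBetti C (2 * 1),
                complexGysin μ (IsSmoothProjective.tensor_holds hA hC) hA
                    (SemiCartesianMonoidalCategory.fst A C)
                    (rfl : 2 * 1 + 2 * 2 + 2 * 2 = 2 * 1 + 2 * (2 + 2))
                    (cupProduct (rfl : 2 * 1 + 2 * 2 = 2 * 1 + 2 * 2)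
                      (complexBetti.map (SemiCartesianMonoidalCategory.snd A C) (2 * 1) x) γ₂) =
                  complexGysin μ (IsSmoothProjective.tensor_holds hA hB) hA
                    (SemiCartesianMonoidalCategory.fst A B)
                    (rfl : 2 * 1 + 2 * 2 + 2 * 2 = 2 * 1 + 2 * (2 + 2))
                    (cupProduct (rfl : 2 * 1 + 2 * 2 = 2 * 1 + 2 * 2)
                      (complexBetti.map (SemiCartesianMonoidalCategory.snd A B) (2 * 1)
                        (complexGysin μ (IsSmoothProjective.tensor_holds hB hC) hB
                          (SemiCartesianMonoidalCategory.fst B C)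
                          (rfl : 2 * 1 + 2 * 2 + 2 * 2 = 2 * 1 + 2 * (2 + 2))
                          (cupProduct (rfl : 2 * 1 + 2 * 2 = 2 * 1 + 2 * 2)
                            (complexBetti.map (SemiCartesianMonoidalCategory.snd B C) (2 * 1) x)
                            γ₁)))
                      γ)) :
    TwinAnchorGlue :=
  fun hB hA => twinSimilitudeAlgebraic_of_anchor hB hC hA

/-- **`TwinAnchorGlue` from the multiplicativity `N² ∪ N² ⊆ N⁴` of algebraically supported
classes on triple products of smooth projective surfaces** (Voisin II Prop. 9.20 on the coniveau
carrier, the hypothesis `hCUP` of `Literature.AlgebraicGeometry.HodgeTheory.corrComp_surfaces_of_cup'`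
verbatim): with it the composition of algebraic correspondences between surfaces is a theorem of
the tree (`corrComp_surfaces_of_cup'`: Künneth spanning + Gysin base change for the product square
+ `corrCompClass_mem_algebraicClasses`), and `twinAnchorGlue_of_corrComp` applies. This is exactly
what the item `TwinAnchorGlue` (stmt-HodgeConjecture-14394) hinges on in the tree.
[cite: VoisinHodgeII2003, §9.2.4 Prop. 9.20] [cite: Buskin2019, Lemma 6.3]
[cite: Fulton1998, §16.1 Prop. 16.1.1] -/
theorem twinAnchorGlue_of_cup
    (hCUP : ∀ (A B C : SchemeOver ℂ), IsSmoothProjective 2 A → IsSmoothProjective 2 B →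
      IsSmoothProjective 2 C →
      ∀ a ∈ algebraicClasses (A ⊗ (B ⊗ C)) 2, ∀ b ∈ algebraicClasses (A ⊗ (B ⊗ C)) 2,
        cupProduct ((Nat.mul_add 2 2 2).symm : 2 * 2 + 2 * 2 = 2 * (2 + 2)) a b ∈
          algebraicClasses (A ⊗ (B ⊗ C)) (2 + 2)) :
    TwinAnchorGlue :=
  twinAnchorGlue_of_corrComp (corrComp_surfaces_of_cup' hCUP)

/-- **`TwinAnchorGlue` from the moving lemma for `2`-cycles on the triple products `A ⊗ (B ⊗ C)` of
smooth projective surfaces**, in the support form consumed by the tree's reduction theorem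
`Literature.AlgebraicGeometry.HodgeTheory.cupProduct_mem_algebraicClasses_of_moving` (`l = k = 2`):
every class of `H⁴((A ⊗ (B ⊗ C))(ℂ); ℂ)` killed off a Zariski-closed `Z` of codimension `≥ 2` lies
in the span of the classes killed off closed `T` meeting a given closed `W` of codimension `≥ 2` in
codimension `≥ 4` at every point (in print: purity `ker = span cl(Zⱼ)`, Chow's moving lemma
"there is a cycle `α'` rationally equivalent to `α` such that `α'` meets `β` properly", and the
invariance and support of `cl`; Fulton §11.4, Voisin II Lemma 9.22). Under it `hCUP` holds on those
sixfolds (`cupProduct_mem_algebraicClasses_of_moving`) and `twinAnchorGlue_of_cup` applies.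
[cite: Fulton1998, §11.4 Moving Lemma] [cite: VoisinHodgeII2003, §9.2.4 Prop. 9.20 and Lemma 9.22] -/
theorem twinAnchorGlue_of_moving
    (hmove : ∀ (A B C : SchemeOver ℂ), IsSmoothProjective 2 A → IsSmoothProjective 2 B →
      IsSmoothProjective 2 C →
      ∀ ⦃Z W : Set (A ⊗ (B ⊗ C)).left⦄, IsClosed Z → (∀ z ∈ Z, ((2 : ℕ) : ℕ∞) ≤ Order.coheight z) →
        IsClosed W → (∀ w ∈ W, ((2 : ℕ) : ℕ∞) ≤ Order.coheight w) →
          LinearMap.ker (complexBetti.restrictCompl (A ⊗ (B ⊗ C)) Z (2 * 2)).hom ≤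
            ⨆ (T : Set (A ⊗ (B ⊗ C)).left) (_ : IsClosed T)
              (_ : ∀ t ∈ T ∩ W, ((2 + 2 : ℕ) : ℕ∞) ≤ Order.coheight t),
              LinearMap.ker (complexBetti.restrictCompl (A ⊗ (B ⊗ C)) T (2 * 2)).hom) :
    TwinAnchorGlue :=
  twinAnchorGlue_of_cup fun A B C hA hB hC _a ha _b hb =>
    cupProduct_mem_algebraicClasses_of_moving (hmove A B C hA hB hC) ha hb

/-! ### The sharper residual: only the PULLED-BACK product `p₁₂^* γ ∪ p₂₃^* γ₁` must be algebraic -/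

open AlgebraicGeometry CartesianMonoidalCategory

/-- **Composition of algebraic correspondences between surfaces from the algebraicity of the one
cup product it uses.** For smooth projective surfaces `A, B, C` and algebraic
`γ ∈ N²H⁴((A ⊗ B)(ℂ))`, `γ₁ ∈ N²H⁴((B ⊗ C)(ℂ))`, IF the class
`(A ◁ fst)^* γ ∪ snd^* γ₁ ∈ H⁸((A ⊗ (B ⊗ C))(ℂ))` (`= p₁₂^* γ ∪ p₂₃^* γ₁`) is algebraic
(`∈ N⁴H⁸`), then `γ₂ := c • (A ◁ snd)_* (p₁₂^* γ ∪ p₂₃^* γ₁)` is algebraic (push-forwards preserve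
algebraic classes, `complexGysin_mem_algebraicClasses`) and `[γ₂]_* = [γ]_* ∘ [γ₁]_*` on
`H²(C(ℂ); ℂ)` (`corr_comp_of_baseChange` with the tree's unconditional `gysin_baseChange`). This is
`Literature.AlgebraicGeometry.HodgeTheory.corrComp_surfaces_of_cup` with its hypothesis `hCUP`
(`N² ∪ N² ⊆ N⁴` for ALL pairs of algebraic classes on the sixfold) weakened to the pulled-back
pairs actually multiplied (Fulton Def. 16.1.1: `β ∘ α = p₁₃*(p₁₂^*α · p₂₃^*β)`; Buskin Lemma 6.3).
By the cup product with supports (`cupProduct_mem_supportedClasses_of_inter`) the weakened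
hypothesis holds whenever `γ`, `γ₁` die off closed `Z ⊆ A ⊗ B`, `Z₁ ⊆ B ⊗ C` with
`(Z × C) ∩ (A × Z₁)` of codimension `≥ 4`; what it still asks for is the improper case.
[cite: Fulton1998, §16.1 Def. 16.1.1 and Prop. 16.1.1] [cite: Buskin2019, Lemma 6.3] -/
theorem corrComp_surfaces_of_cupPullback (μ : OrientationFamily)
    (hCUP' : ∀ (A B C : SchemeOver ℂ), IsSmoothProjective 2 A → IsSmoothProjective 2 B →
      IsSmoothProjective 2 C →
      ∀ γ ∈ algebraicClasses (A ⊗ B) 2, ∀ γ₁ ∈ algebraicClasses (B ⊗ C) 2,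
        cupProduct ((Nat.mul_add 2 2 2).symm : 2 * 2 + 2 * 2 = 2 * (2 + 2))
          (complexBetti.map (A ◁ fst B C) (2 * 2) γ)
          (complexBetti.map (snd A (B ⊗ C)) (2 * 2) γ₁) ∈
          algebraicClasses (A ⊗ (B ⊗ C)) (2 + 2))
    (A B C : SchemeOver ℂ) (hA : IsSmoothProjective 2 A) (hB : IsSmoothProjective 2 B)
    (hC : IsSmoothProjective 2 C) :
    ∀ γ ∈ algebraicClasses (A ⊗ B) 2, ∀ γ₁ ∈ algebraicClasses (B ⊗ C) 2,
      ∃ γ₂ ∈ algebraicClasses (A ⊗ C) 2, ∀ x : complexBetti C (2 * 1),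
        complexGysin μ (IsSmoothProjective.tensor_holds hA hC) hA (fst A C)
            (rfl : 2 * 1 + 2 * 2 + 2 * 2 = 2 * 1 + 2 * (2 + 2))
            (cupProduct (rfl : 2 * 1 + 2 * 2 = 2 * 1 + 2 * 2)
              (complexBetti.map (snd A C) (2 * 1) x) γ₂) =
          complexGysin μ (IsSmoothProjective.tensor_holds hA hB) hA (fst A B)
            (rfl : 2 * 1 + 2 * 2 + 2 * 2 = 2 * 1 + 2 * (2 + 2))
            (cupProduct (rfl : 2 * 1 + 2 * 2 = 2 * 1 + 2 * 2)
              (complexBetti.map (snd A B) (2 * 1)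
                (complexGysin μ (IsSmoothProjective.tensor_holds hB hC) hB (fst B C)
                  (rfl : 2 * 1 + 2 * 2 + 2 * 2 = 2 * 1 + 2 * (2 + 2))
                  (cupProduct (rfl : 2 * 1 + 2 * 2 = 2 * 1 + 2 * 2)
                    (complexBetti.map (snd B C) (2 * 1) x) γ₁)))
              γ) := by
  intro γ hγ γ₁ hγ₁
  have hμ : μ.HasPoincareDuality := OrientationFamily.hasPoincareDuality μ
  obtain ⟨c, hc⟩ :=
    gysin_baseChange μ hA hB hC (show 2 * 1 + 2 * 2 + 2 * 2 = 2 * 1 + 2 * (2 + 2) from rfl)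
  refine ⟨c • complexGysin μ
      (IsSmoothProjective.tensor_holds hA (IsSmoothProjective.tensor_holds hB hC))
      (IsSmoothProjective.tensor_holds hA hC) (A ◁ snd B C)
      (show 2 * (2 + 2) + 2 * (2 + 2) = 2 * 2 + 2 * (2 + (2 + 2)) by omega)
      (cupProduct ((Nat.mul_add 2 2 2).symm : 2 * 2 + 2 * 2 = 2 * (2 + 2))
        (complexBetti.map (A ◁ fst B C) (2 * 2) γ) (complexBetti.map (snd A (B ⊗ C)) (2 * 2) γ₁)),
    Submodule.smul_mem _ c
      (complexGysin_mem_algebraicClasses (gysinMap_restrictCompl_eq_zero_of_field ℂ) μ hμ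
        (IsSmoothProjective.tensor_holds hA (IsSmoothProjective.tensor_holds hB hC))
        (IsSmoothProjective.tensor_holds hA hC) (A ◁ snd B C)
        (show 2 + 2 + (2 + 2) = 2 + (2 + (2 + 2)) by omega) _ (hCUP' A B C hA hB hC γ hγ γ₁ hγ₁)),
    fun x ↦ ?_⟩
  exact corr_comp_of_baseChange hμ hA hB hC (e := 2) (j := 2 * 2) (k := 2 * 2) (d := 2 * (2 + 2))
    (a := 2 * 1) (a₁ := 2 * 1) (a₂ := 2 * 1) rfl rfl rfl ((Nat.mul_add 2 2 2).symm) γ γ₁ c hc x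

/-- **The proper case of the pulled-back product is free** (cup product with supports, Fulton
§19.2, on the tree's carrier: `cupProduct_mem_supportedClasses_of_inter`): if `γ` dies off a
Zariski-closed `Z ⊆ A ⊗ B` and `γ₁` dies off a Zariski-closed `Z₁ ⊆ B ⊗ C`, and every point of
`p₁₂⁻¹Z ∩ p₂₃⁻¹Z₁ ⊆ A ⊗ (B ⊗ C)` has codimension `≥ 4`, then `p₁₂^* γ ∪ p₂₃^* γ₁` is algebraic
(restriction commutes with pull-back, `complexBetti.restrictCompl_map_eq_zero`, and supports
multiply). So the hypothesis `hCUP'` of `corrComp_surfaces_of_cupPullback` has content only for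
supports meeting IMPROPERLY over `B` — the case addressed in print by Chow's moving lemma
(Fulton §11.4). [cite: Fulton1998, §19.2 Cor. 19.2 and §11.4] -/
theorem cupPullback_mem_algebraicClasses_of_inter {A B C : SchemeOver ℂ}
    {Z : Set (A ⊗ B).left} {Z₁ : Set (B ⊗ C).left} (hZ : IsClosed Z) (hZ₁ : IsClosed Z₁)
    (h4 : ∀ t ∈ (A ◁ fst B C).left.base ⁻¹' Z ∩ (snd A (B ⊗ C)).left.base ⁻¹' Z₁,
      ((2 + 2 : ℕ) : ℕ∞) ≤ Order.coheight t)
    {γ : complexBetti (A ⊗ B) (2 * 2)} {γ₁ : complexBetti (B ⊗ C) (2 * 2)}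
    (hγ : complexBetti.restrictCompl (A ⊗ B) Z (2 * 2) γ = 0)
    (hγ₁ : complexBetti.restrictCompl (B ⊗ C) Z₁ (2 * 2) γ₁ = 0) :
    cupProduct ((Nat.mul_add 2 2 2).symm : 2 * 2 + 2 * 2 = 2 * (2 + 2))
        (complexBetti.map (A ◁ fst B C) (2 * 2) γ)
        (complexBetti.map (snd A (B ⊗ C)) (2 * 2) γ₁) ∈
      algebraicClasses (A ⊗ (B ⊗ C)) (2 + 2) :=
  cupProduct_mem_supportedClasses_of_inter
    (hZ.preimage (A ◁ fst B C).left.base.hom.continuous)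
    (hZ₁.preimage (snd A (B ⊗ C)).left.base.hom.continuous) h4 _
    (complexBetti.restrictCompl_map_eq_zero (A ◁ fst B C) hγ)
    (complexBetti.restrictCompl_map_eq_zero (snd A (B ⊗ C)) hγ₁)

/-- **`TwinAnchorGlue` from the algebraicity of the pulled-back products `p₁₂^* γ ∪ p₂₃^* γ₁`
alone** (the sharpest form of what the item hinges on: for smooth projective surfaces `A, B, C`
and algebraic `γ` on `A ⊗ B`, `γ₁` on `B ⊗ C`, the class `(A ◁ fst)^* γ ∪ snd^* γ₁` on
`A ⊗ (B ⊗ C)` is algebraic — Fulton's `p₁₂^* α · p₂₃^* β`, the moving-lemma input of the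
composition of correspondences; `corrComp_surfaces_of_cupPullback` + `twinAnchorGlue_of_corrComp`).
[cite: Fulton1998, §16.1 Def. 16.1.1] [cite: Varesco2023, §2] -/
theorem twinAnchorGlue_of_cupPullback
    (hCUP' : ∀ (A B C : SchemeOver ℂ), IsSmoothProjective 2 A → IsSmoothProjective 2 B →
      IsSmoothProjective 2 C →
      ∀ γ ∈ algebraicClasses (A ⊗ B) 2, ∀ γ₁ ∈ algebraicClasses (B ⊗ C) 2,
        cupProduct ((Nat.mul_add 2 2 2).symm : 2 * 2 + 2 * 2 = 2 * (2 + 2))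
          (complexBetti.map (A ◁ fst B C) (2 * 2) γ)
          (complexBetti.map (snd A (B ⊗ C)) (2 * 2) γ₁) ∈
          algebraicClasses (A ⊗ (B ⊗ C)) (2 + 2)) :
    TwinAnchorGlue :=
  twinAnchorGlue_of_corrComp fun μ _ A B C hA hB hC ↦
    corrComp_surfaces_of_cupPullback μ hCUP' A B C hA hB hC

end Summit.HodgeConjecture.HodgeConjecture.Theorems

end
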